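import Summits.CriticalPhenomena.PercolationContinuityZ3.Theorems.Transplant.SkelSign1Params
import HarnessLib

/-!
# D″ L7′ params, part 5b: **`PlanarSkeletonSign.signChoice₁`** — `signChoice₀` (p253201) with ONE value corrected: the fibre block's `ψM` slot is
# the SEED-DEPTH `ψMz := max (ψ M) ρz` (`ρz = ψ Mu + off`), so that `L_A ∋ Rex q (2·ψMz)` certifies the INNER routes' rim excess for entrances as
# deep as the wired seed `D.Λ c D.k` (graph depth `ψ(D.k) + off ≤ ρz`; in gen 7 the seed was the cube of scale `M`, whence `2ψM`; in D″ the Step-I′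
# offset `off` is independent of `ψ`, so `signChoice₀`'s slot `ψ M` does not cover it — hp-8 g30's (F) binders `hR₁A`/`hRA`, SIGN-PARAMS.md §9 (F)(g)).
# Everything else is `signChoice₀`'s: the same `Sgn.*` values (cells, units, strides, lists, counts, accuracies, `Rex`, `topScale`, `reachK`);
# only `schedIn₁`/`Λ₁`/`choiceAt₁` differ.  THIS is the choice function the three residue wrappers target (`rootHoldsFn_signChoice₁`, …) and the
# (Z″) closure reads `samePDropOfSkeletonSign₁_of_choiceFnRH signChoice₁ wfHoldsFn_signChoice₁ …`.

builds on p205010 (kernel theorem, internal audit signed; external expert review pending) — nothing in this file uses p205010.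
Status sentence (coordinator 2026-08-20T04:30Z): "θ(p_c) = 0 on ℤ^d, all d ≥ 2 — kernel-verified (Lean 4/Mathlib, standard axioms); internal adversarial
audit SIGNED 2026-08-20 04:29Z; external expert review pending."
Lane `prim-bschramm-*`, seat `prim-bschramm-stmt` (gen 9); helper file (`--supports stmt-CriticalPhenomena-4575`).
[cite: KozmaNitzan2024, §4 Theorem 6 (pp. 25–31): the order of constants; Lemma 12 (p. 24)]
-/

noncomputable section

open MeasureTheory
open scoped Classical

namespace Summit.CriticalPhenomena.PercolationContinuityZ3.Theorems.Transplant

namespace PlanarSkeletonSign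

namespace Sgn

open Literature.Probability.Percolation Literature.Probability.LatticeModels SimpleGraph
open SkelConc (Consts)
open BoxProdZ2 (ConcRadiiG Kof twenty_le_Kof le_Kof)

section OLevel

variable (κ : Consts) {V : Type} [DecidableEq V] [Countable V] {G : SimpleGraph V} [G.LocallyFinite] (Φ : PlanarSkeletonSign G)
  (p : unitInterval) (O : Skelφ.StepI.Out V)

/-- **The seed-depth slot** `ψMz := max (ψ M) ρz` (`ρz = ψ Mu + off ≥ ψ(D.k) + off` = the graph depth of the wired seed about a kit centre).
[this work] -/
def ψMz : ℕ := max (O.D.R (M O)) (ρz O)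

/-- The inputs of the fibre block at `q`, corrected: the `ψM` slot is `ψMz`. [this work] -/
def schedIn₁ (q : unitInterval) : Skelφ.Prm.SchedIn :=
  ⟨(cells κ Φ p O).rmax, topScale κ Φ p O, M O, ψMz O, O.D.R (topScale κ Φ p O), reachK Φ O, Rex κ Φ p O q⟩

/-- **The radius schedule at `q`**, corrected: `Skelφ.Prm.sched (schedIn₁ q) cells`. [this work] -/
def Λ₁ (q : unitInterval) : ConcRadiiG := Skelφ.Prm.sched (schedIn₁ κ Φ p O q) (cells κ Φ p O)

end OLevel

section Bundle

variable (κ : Consts) {V : Type} [DecidableEq V] [Countable V] {G : SimpleGraph V} [G.LocallyFinite] (Φ : PlanarSkeletonSign G)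
  (t : V) (p : unitInterval) (hC : Φ.CylSubcritical p)

/-- **THE CONCRETE CHOICES, corrected** (`Λ := Λ₁`; all other fields as `choiceAt`). [this work] -/
def choiceAt₁ : Choice κ Φ t p hC where
  δI := δI κ Φ
  m₀ := m₀ κ
  Sz := fun O => Sz O
  Sx := fun O => Sx κ Φ p O
  Sy := fun O => Sy κ Φ p O
  P := fun O => cells κ Φ p O
  Λ := fun O q => Λ₁ κ Φ p O q
  δI_pos := Skelφ.Prm.δI_pos G Φ.degree_le κ (A κ)
  S_adm := fun O hF _ htwo => S_adm κ Φ p hC O hF htwo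

end Bundle

end Sgn

/-- **THE CONCRETE CHOICE FUNCTION OF RECORD for the single-type D″ node**: `Sgn.choiceAt₁`. [cite: KozmaNitzan2024, §4 Theorem 6 (pp. 25–31)] -/
def signChoice₁ : ChoiceFn :=
  fun κ _ _ _ _ _ Φ _ t _ _ _ p _ _ hC => Sgn.choiceAt₁ κ Φ t p hC

/-- `signChoice₁` unfolds to `Sgn.choiceAt₁` (by `rfl`). [folklore] -/
theorem signChoice₁_eq (κ : SkelConc.Consts) {V : Type} [DecidableEq V] [Countable V] (G : SimpleGraph V) [G.LocallyFinite]
    (Φ : PlanarSkeletonSign G) (hg : ¬ Literature.Barriers.CriticalPhenomena.HasExponentialGrowth G) (t : V) (ht : t ∈ Φ.types)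
    (h1 : Φ.types = {t}) (h0 : Φ.φ t = 0) (p : unitInterval) (hp0 : 0 < (p : ℝ)) (hp1 : (p : ℝ) < 1) (hC : Φ.CylSubcritical p) :
    signChoice₁ κ G Φ hg t ht h1 h0 p hp0 hp1 hC = Sgn.choiceAt₁ κ Φ t p hC := rfl

/-- **The corrected choices are well formed**: `WFS2 P (Λ₁ O q)` (`Skelφ.Prm.sched_WFS2`) and `K₀ ≤ K = Kof K₀`. [this work] -/
theorem wfHoldsFn_signChoice₁ : WFHoldsFn signChoice₁ := by
  intro κ V _ _ G _ Φ hg t ht h1 h0 p hp0 hp1 hC O q _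
  exact ⟨Skelφ.Prm.sched_WFS2 _ _, BoxProdZ2.le_Kof κ.K₀⟩

end PlanarSkeletonSign

end Summit.CriticalPhenomena.PercolationContinuityZ3.Theorems.Transplant

end
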